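import Summits.QuantumFields.YangMills.Theorems.ColdStartUniversalityLatticeLangevinLinkFieldCarre
import Summits.QuantumFields.YangMills.Theorems.ColdStartUniversalityLatticeLangevinPlaquetteVariance
import HarnessLib

/-!
# Route `ColdStartUniversality` (fixed-cut-off package, Bakry–Émery side): VOLUME-UNIFORM VARIANCE AND CONCENTRATION OF THE AVERAGED LINK
# FIELD `(#E)⁻¹ Σ_e Re tr(Q_e Eᴴ)` under the SU(2) Wilson measure `μ_(β')` on `(ℤ/L)³` at `|β'| < 1/12` (Shen–Zhu–Zhu's link susceptibility)

Helper file (seat `ym-line-csu-p1`, g27; `--supports stmt-QuantumFields-24809`).  For a fixed matrix `E ∈ M₂(ℂ)` (`‖E‖² = Re tr(EEᴴ)`) the link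
field `Λ_E(V) = Σ_e Re tr(ρ(V_e) Eᴴ)` of an `SU(2)` lattice gauge field (`#E = 3L³` links):
* ★★ `wilson_linkField_variance_uniform` — `Var_(μ_β')(Λ_E/#E) ≤ ‖E‖²/((1 − 12|β'|)·#E)`;
* ★★ `wilson_linkField_totalVariance_uniform` — `Var_(μ_β')(Λ_E) = Σ_(e,e') Cov(⟨Q_e,E⟩,⟨Q_e',E⟩) ≤ ‖E‖²·#E/(1 − 12|β'|)`: the LINK
  SUSCEPTIBILITY is bounded uniformly in the volume at strong coupling — Shen–Zhu–Zhu Cor. 4.7 (`Σ_e Cov(⟨Q_e₀,E⟩,⟨Q_e,E⟩) ≤ 2/K_𝒮` for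
  `SU(N)`, unit `E`) in averaged form for `SU(2)`, `d = 3`, in the tree's normalisation;
* ★★★ `wilson_linkField_concentration_uniform` — for `‖E‖² > 0`, `r ≥ 0`:
  `μ_(β'){V | r ≤ |Λ_E(V)/#E − ∫ Λ_E/#E dμ_(β')|} ≤ 2·exp(−(1 − 12|β'|)·#E·r²/(2‖E‖²))`.
Inputs: `wilson_linkField_carre_le` (`Γ(cΛ_E) ≤ 2c²‖E‖²#E`), `wilson_variance_le_of_carre_uniform`, `wilson_concentration_uniform`.
[cite: ShenZhuZhu2022, §4 Corollary 4.7]  HONEST FRAMING: FIXED cut-off and fixed `|β'| < 1/12`; 24809 ASIDE not restated; no crux, rung or summit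
statement is proved; the Yang–Mills mass gap is NOT proved.  THEOREMS ONLY, no definition, no sorry.
-/

set_option autoImplicit false

noncomputable section

namespace Summit.QuantumFields.YangMills.Theorems.ColdStartUniversality

open MeasureTheory ProbabilityTheory Finset Filter Set
open scoped BigOperators NNReal ENNReal Topology Matrix
open Literature.MathematicalPhysics.QuantumFieldTheory
open Literature.MathematicalPhysics.QuantumLattice (fundamentalRep fundamentalLatticeRep continuous_fundamentalRep)

variable {L : ℕ} [NeZero L]

/-! ## §1. The link field through the coordinates -/

/-- `0 < #E`. [folklore] -/
theorem card_edge_three_pos (L : ℕ) [NeZero L] : 0 < (Fintype.card (Edge 3 L) : ℝ) := by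
  have : 0 < Fintype.card (Edge 3 L) := Fintype.card_pos_iff.2 ⟨((fun _ => 0), 0)⟩
  exact_mod_cast this

/-- The coordinate form of the link field reads `c·Λ_E` on the group: `(c·Σ_e Re tr((rebuild y)_e Eᴴ))(coords V) = c·Σ_e Re tr(ρ(V_e) Eᴴ)`.
[folklore] -/
theorem linkField_coords_eq (E : Matrix (Fin 2) (Fin 2) ℂ) (c : ℝ) (V : (GaugeConfig 3 L (Matrix.specialUnitaryGroup (Fin 2) ℂ))) :
    (fun y : (Edge 3 L × Fin 2 × Fin 2 × Bool → ℝ) => c * ∑ e : Edge 3 L, (((fun (ee : Edge 3 L) => Matrix.of fun (i j : Fin 2) => ((y (ee, i, j, false) : ℝ) : ℂ) + ((y (ee, i, j, true) : ℝ) : ℂ) * Complex.I) e) * Eᴴ).trace.re) ((fun (V : GaugeConfig 3 L (Matrix.specialUnitaryGroup (Fin 2) ℂ)) (q : Edge 3 L × Fin 2 × Fin 2 × Bool) => (fun z : ℂ => if q.2.2.2 then z.im else z.re) ((fundamentalRep (Fin 2) (V q.1) : Matrix (Fin 2) (Fin 2) ℂ) q.2.1 q.2.2.1)) V) = c * (∑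 e : Edge 3 L, ((fundamentalRep (Fin 2) (V e) : Matrix (Fin 2) (Fin 2) ℂ) * Eᴴ).trace.re) := by
  have hrebQ : ∀ e : Edge 3 L, (Matrix.of fun a b : Fin 2 => ((((fun (V : GaugeConfig 3 L (Matrix.specialUnitaryGroup (Fin 2) ℂ)) (q : Edge 3 L × Fin 2 × Fin 2 × Bool) => (fun z : ℂ => if q.2.2.2 then z.im else z.re) ((fundamentalRep (Fin 2) (V q.1) : Matrix (Fin 2) (Fin 2) ℂ) q.2.1 q.2.2.1)) V) (e, a, b, false) : ℝ) : ℂ) + ((((fun (V : GaugeConfig 3 L (Matrix.specialUnitaryGroup (Fin 2) ℂ)) (q : Edge 3 L × Fin 2 × Fin 2 × Bool) => (fun z : ℂ => if q.2.2.2 then z.im else z.re) ((fundamentalRep (Fin 2) (V q.1) : Matrix (Fin 2) (Fin 2) ℂ) q.2.1 q.2.2.1)) V) (e, a, b, true) : ℝ) : ℂ) * Complex.I) =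
      (fundamentalRep (Fin 2) (V e) : Matrix (Fin 2) (Fin 2) ℂ) :=
    fun e => (congrFun (rebuild_coords_of V) e).trans (Matrix.ext fun a b => rfl)
  show c * ∑ e : Edge 3 L, ((Matrix.of fun a b : Fin 2 => ((((fun (V : GaugeConfig 3 L (Matrix.specialUnitaryGroup (Fin 2) ℂ)) (q : Edge 3 L × Fin 2 × Fin 2 × Bool) => (fun z : ℂ => if q.2.2.2 then z.im else z.re) ((fundamentalRep (Fin 2) (V q.1) : Matrix (Fin 2) (Fin 2) ℂ) q.2.1 q.2.2.1)) V) (e, a, b, false) : ℝ) : ℂ) + ((((fun (V : GaugeConfig 3 L (Matrix.specialUnitaryGroup (Fin 2) ℂ)) (q : Edge 3 L × Fin 2 × Fin 2 × Bool) => (fun z : ℂ => if q.2.2.2 then z.im else z.re) ((fundamentalRep (Fin 2) (V q.1) : Matrix (Fin 2) (Fin 2) ℂ) q.2.1 q.2.2.1)) V) (e, a, b, true) : ℝ) : ℂ) * Complex.I) * Eᴴ).trace.re = c * (∑ e : Edge 3 L, ((fundamentalRep (Fin 2) (V e) : Matrix (Fin 2) (Fin 2) ℂ) * Eᴴ).t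race.re)
  congr 1
  exact Finset.sum_congr rfl fun e _ => by rw [hrebQ e]

/-- The coordinate form of the link field is smooth. [folklore] -/
theorem contDiff_linkField (E : Matrix (Fin 2) (Fin 2) ℂ) (c : ℝ) {n : WithTop ℕ∞} : ContDiff ℝ n (fun y : (Edge 3 L × Fin 2 × Fin 2 × Bool → ℝ) => c * ∑ e : Edge 3 L, (((fun (ee : Edge 3 L) => Matrix.of fun (i j : Fin 2) => ((y (ee, i, j, false) : ℝ) : ℂ) + ((y (ee, i, j, true) : ℝ) : ℂ) * Complex.I) e) * Eᴴ).trace.re) := by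
  refine contDiff_const.mul (ContDiff.sum fun e _ => ?_)
  have hR : ∀ (a b : Fin 2), ContDiff ℝ n fun z : (Edge 3 L × Fin 2 × Fin 2 × Bool → ℝ) =>
      (fun (ee : Edge 3 L) => Matrix.of fun (i j : Fin 2) => ((z (ee, i, j, false) : ℝ) : ℂ) + ((z (ee, i, j, true) : ℝ) : ℂ) * Complex.I) e a b :=
    fun a b => contDiff_entry_rebuild (N := 2) e a b
  exact contDiff_re_trace (contDiff_entry_mul hR (fun a b => contDiff_const))

/-! ## §2. Variance (link susceptibility) -/

/-- ★★ **Volume-uniform variance of the averaged link field**: `Var_(μ_β')(Λ_E/#E) ≤ ‖E‖²/((1 − 12|β'|)·#E)` for every `L`, `|β'| < 1/12`,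
`E ∈ M₂(ℂ)`. [cite: ShenZhuZhu2022, §4 Corollary 4.7] -/
theorem wilson_linkField_variance_uniform (L : ℕ) [NeZero L] (β' : ℝ) (hβ : |β'| < 1 / 12) (E : Matrix (Fin 2) (Fin 2) ℂ) :
    ∫ V, ((∑ e : Edge 3 L, ((fundamentalRep (Fin 2) (V e) : Matrix (Fin 2) (Fin 2) ℂ) * Eᴴ).trace.re) / (Fintype.card (Edge 3 L) : ℝ) - ∫ V', (∑ e : Edge 3 L, ((fundamentalRep (Fin 2) (V' e) : Matrix (Fin 2) (Fin 2) ℂ) * Eᴴ).trace.re) / (Fintype.card (Edge 3 L) : ℝ) ∂(wilsonMeasure (d := 3) (L := L) (fundamentalRep (Fin 2)) β')) ^ 2 ∂(wilsonMeasure (d := 3) (L := L) (fundamentalRep (Fin 2)) β')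
      ≤ (E * Eᴴ).trace.re / ((1 - 12 * |β'|) * (Fintype.card (Edge 3 L) : ℝ)) := by
  classical
  haveI := secondCountableTopology_su2
  haveI := borelSpace_config L
  set μ : Measure (GaugeConfig 3 L (Matrix.specialUnitaryGroup (Fin 2) ℂ)) := (wilsonMeasure (d := 3) (L := L) (fundamentalRep (Fin 2)) β') with hμ
  haveI : IsProbabilityMeasure μ :=
    isProbabilityMeasure_wilsonMeasure (d := 3) (L := L) (fundamentalRep (Fin 2)) (continuous_fundamentalRep (Fin 2)) β'
  have hρ : 0 < 1 - 12 * |β'| := by linarith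
  set nE : ℝ := (Fintype.card (Edge 3 L) : ℝ) with hnE
  have hnEpos : 0 < nE := card_edge_three_pos L
  set b : ℝ := nE⁻¹ with hb
  set co : (GaugeConfig 3 L (Matrix.specialUnitaryGroup (Fin 2) ℂ)) → (Edge 3 L × Fin 2 × Fin 2 × Bool → ℝ) := (fun (V : GaugeConfig 3 L (Matrix.specialUnitaryGroup (Fin 2) ℂ)) (q : Edge 3 L × Fin 2 × Fin 2 × Bool) => (fun z : ℂ => if q.2.2.2 then z.im else z.re) ((fundamentalRep (Fin 2) (V q.1) : Matrix (Fin 2) (Fin 2) ℂ) q.2.1 q.2.2.1)) with hco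
  set fp : (Edge 3 L × Fin 2 × Fin 2 × Bool → ℝ) → ℝ := (fun y : (Edge 3 L × Fin 2 × Fin 2 × Bool → ℝ) => b * ∑ e : Edge 3 L, (((fun (ee : Edge 3 L) => Matrix.of fun (i j : Fin 2) => ((y (ee, i, j, false) : ℝ) : ℂ) + ((y (ee, i, j, true) : ℝ) : ℂ) * Complex.I) e) * Eᴴ).trace.re) with hfp
  have hfpC : ContDiff ℝ 3 fp := contDiff_linkField E b
  have hval : ∀ V : (GaugeConfig 3 L (Matrix.specialUnitaryGroup (Fin 2) ℂ)), fp (co V) = (∑ e : Edge 3 L, ((fundamentalRep (Fin 2) (V e) : Matrix (Fin 2) (Fin 2) ℂ) * Eᴴ).trace.re) / nE := by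
    intro V
    have h : fp (co V) = b * (∑ e : Edge 3 L, ((fundamentalRep (Fin 2) (V e) : Matrix (Fin 2) (Fin 2) ℂ) * Eᴴ).trace.re) := linkField_coords_eq E b V
    rw [h, hb, div_eq_inv_mul]
  have hvar : ∫ V, (fp (co V) - ∫ V', fp (co V') ∂μ) ^ 2 ∂μ ≤ (2 * b ^ 2 * (E * Eᴴ).trace.re * nE) / (2 * (1 - 12 * |β'|)) :=
    wilson_variance_le_of_carre_uniform L β' fp hfpC (2 * b ^ 2 * (E * Eᴴ).trace.re * nE) hβ (wilson_linkField_carre_le L β' E b)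
  have hI : ∫ V, ((∑ e : Edge 3 L, ((fundamentalRep (Fin 2) (V e) : Matrix (Fin 2) (Fin 2) ℂ) * Eᴴ).trace.re) / nE - ∫ V', (∑ e : Edge 3 L, ((fundamentalRep (Fin 2) (V' e) : Matrix (Fin 2) (Fin 2) ℂ) * Eᴴ).trace.re) / nE ∂μ) ^ 2 ∂μ = ∫ V, (fp (co V) - ∫ V', fp (co V') ∂μ) ^ 2 ∂μ := by
    refine integral_congr_ae (ae_of_all _ fun V => ?_)
    beta_reduce
    rw [hval V]
    congr 2
    exact integral_congr_ae (ae_of_all _ fun V' => by beta_reduce; rw [hval V'])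
  have hconst : (2 * b ^ 2 * (E * Eᴴ).trace.re * nE) / (2 * (1 - 12 * |β'|)) = (E * Eᴴ).trace.re / ((1 - 12 * |β'|) * nE) := by
    rw [hb]
    field_simp
  rw [hI, ← hconst]
  exact hvar

/-- ★★ **Volume-uniform link susceptibility**: `Var_(μ_β')(Λ_E) = Σ_(e,e') Cov(⟨Q_e,E⟩,⟨Q_e',E⟩) ≤ ‖E‖²·#E/(1 − 12|β'|)` for every `L`,
`|β'| < 1/12`, `E ∈ M₂(ℂ)` (Shen–Zhu–Zhu's `2/K_𝒮` per link for `SU(N)`, in the tree's normalisation). [cite: ShenZhuZhu2022, §4 Corollary 4.7] -/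
theorem wilson_linkField_totalVariance_uniform (L : ℕ) [NeZero L] (β' : ℝ) (hβ : |β'| < 1 / 12) (E : Matrix (Fin 2) (Fin 2) ℂ) :
    ∫ V, ((∑ e : Edge 3 L, ((fundamentalRep (Fin 2) (V e) : Matrix (Fin 2) (Fin 2) ℂ) * Eᴴ).trace.re) - ∫ V', (∑ e : Edge 3 L, ((fundamentalRep (Fin 2) (V' e) : Matrix (Fin 2) (Fin 2) ℂ) * Eᴴ).trace.re) ∂(wilsonMeasure (d := 3) (L := L) (fundamentalRep (Fin 2)) β')) ^ 2 ∂(wilsonMeasure (d := 3) (L := L) (fundamentalRep (Fin 2)) β')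
      ≤ (E * Eᴴ).trace.re * (Fintype.card (Edge 3 L) : ℝ) / (1 - 12 * |β'|) := by
  classical
  haveI := secondCountableTopology_su2
  haveI := borelSpace_config L
  set μ : Measure (GaugeConfig 3 L (Matrix.specialUnitaryGroup (Fin 2) ℂ)) := (wilsonMeasure (d := 3) (L := L) (fundamentalRep (Fin 2)) β') with hμ
  haveI : IsProbabilityMeasure μ :=
    isProbabilityMeasure_wilsonMeasure (d := 3) (L := L) (fundamentalRep (Fin 2)) (continuous_fundamentalRep (Fin 2)) β'
  have hρ : 0 < 1 - 12 * |β'| := by linarith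
  set nE : ℝ := (Fintype.card (Edge 3 L) : ℝ) with hnE
  have hnEpos : 0 < nE := card_edge_three_pos L
  have h := wilson_linkField_variance_uniform L β' hβ E
  have hdiv : ∫ V', (∑ e : Edge 3 L, ((fundamentalRep (Fin 2) (V' e) : Matrix (Fin 2) (Fin 2) ℂ) * Eᴴ).trace.re) / nE ∂μ = (∫ V', (∑ e : Edge 3 L, ((fundamentalRep (Fin 2) (V' e) : Matrix (Fin 2) (Fin 2) ℂ) * Eᴴ).trace.re) ∂μ) / nE := integral_div nE _
  have hsq : ∀ V : (GaugeConfig 3 L (Matrix.specialUnitaryGroup (Fin 2) ℂ)), ((∑ e : Edge 3 L, ((fundamentalRep (Fin 2) (V e) : Matrix (Fin 2) (Fin 2) ℂ) * Eᴴ).trace.re) / nE - ∫ V', (∑ e : Edge 3 L, ((fundamentalRep (Fin 2) (V' e) : Matrix (Fin 2) (Fin 2) ℂ) * Eᴴ).trace.re) / nE ∂μ) ^ 2 = ((∑ e : Edge 3 L, ((fundamentalRep (Fin 2) (V e) : Matrix (Fin 2) (Fin 2) ℂ) * Eᴴ).trace.re) - ∫ V', (∑ e : Edge 3 L, ((fundamentalRep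 (Fin 2) (V' e) : Matrix (Fin 2) (Fin 2) ℂ) * Eᴴ).trace.re) ∂μ) ^ 2 / nE ^ 2 := by
    intro V
    rw [hdiv]
    field_simp
  have hI : ∫ V, ((∑ e : Edge 3 L, ((fundamentalRep (Fin 2) (V e) : Matrix (Fin 2) (Fin 2) ℂ) * Eᴴ).trace.re) / nE - ∫ V', (∑ e : Edge 3 L, ((fundamentalRep (Fin 2) (V' e) : Matrix (Fin 2) (Fin 2) ℂ) * Eᴴ).trace.re) / nE ∂μ) ^ 2 ∂μ = (∫ V, ((∑ e : Edge 3 L, ((fundamentalRep (Fin 2) (V e) : Matrix (Fin 2) (Fin 2) ℂ) * Eᴴ).trace.re) - ∫ V', (∑ e : Edge 3 L, ((fundamentalRep (Fin 2) (V' e) : Matrix (Fin 2) (Fin 2) ℂ) * Eᴴ).trace.re) ∂μ) ^ 2 ∂μ) / nE ^ 2 := by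
    rw [← integral_div]
    exact integral_congr_ae (ae_of_all _ fun V => by beta_reduce; rw [hsq V])
  have h' : (∫ V, ((∑ e : Edge 3 L, ((fundamentalRep (Fin 2) (V e) : Matrix (Fin 2) (Fin 2) ℂ) * Eᴴ).trace.re) - ∫ V', (∑ e : Edge 3 L, ((fundamentalRep (Fin 2) (V' e) : Matrix (Fin 2) (Fin 2) ℂ) * Eᴴ).trace.re) ∂μ) ^ 2 ∂μ) / nE ^ 2 ≤ (E * Eᴴ).trace.re / ((1 - 12 * |β'|) * nE) := by
    rw [← hI]; exact h
  rw [div_le_iff₀ (by positivity)] at h'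
  calc ∫ V, ((∑ e : Edge 3 L, ((fundamentalRep (Fin 2) (V e) : Matrix (Fin 2) (Fin 2) ℂ) * Eᴴ).trace.re) - ∫ V', (∑ e : Edge 3 L, ((fundamentalRep (Fin 2) (V' e) : Matrix (Fin 2) (Fin 2) ℂ) * Eᴴ).trace.re) ∂μ) ^ 2 ∂μ ≤ (E * Eᴴ).trace.re / ((1 - 12 * |β'|) * nE) * nE ^ 2 := h'
    _ = (E * Eᴴ).trace.re * nE / (1 - 12 * |β'|) := by
        field_simp

/-! ## §3. Gaussian concentration -/

/-- ★★★ **Volume-uniform Gaussian concentration of the averaged link field** at `|β'| < 1/12`: for `E ∈ M₂(ℂ)` with `‖E‖² = Re tr(EEᴴ) > 0` and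
`r ≥ 0`, `μ_(β'){V | r ≤ |Λ_E(V)/#E − ∫ Λ_E/#E dμ_(β')|} ≤ 2·exp(−(1 − 12|β'|)·#E·r²/(2‖E‖²))`. [cite: ShenZhuZhu2022, §4 Theorem 4.2, Corollary 4.7] -/
theorem wilson_linkField_concentration_uniform (L : ℕ) [NeZero L] (β' : ℝ) (hβ : |β'| < 1 / 12) (E : Matrix (Fin 2) (Fin 2) ℂ)
    (hE : 0 < (E * Eᴴ).trace.re) (r : ℝ) (hr : 0 ≤ r) :
    ((wilsonMeasure (d := 3) (L := L) (fundamentalRep (Fin 2)) β')).real {V | r ≤ |(∑ e : Edge 3 L, ((fundamentalRep (Fin 2) (V e) : Matrix (Fin 2) (Fin 2) ℂ) * Eᴴ).trace.re) / (Fintype.card (Edge 3 L) : ℝ) - ∫ V', (∑ e : Edge 3 L, ((fundamentalRep (Fin 2) (V' e) : Matrix (Fin 2) (Fin 2) ℂ) * Eᴴ).trace.re) / (Fintype.card (Edge 3 L) : ℝ) ∂(wilsonMeasure (d := 3) (L := L) (fundamentalRep (Fin 2)) β')|} ≤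
      2 * Real.exp (-((1 - 12 * |β'|) * (Fintype.card (Edge 3 L) : ℝ) * r ^ 2 / (2 * (E * Eᴴ).trace.re))) := by
  classical
  haveI := secondCountableTopology_su2
  haveI := borelSpace_config L
  set μ : Measure (GaugeConfig 3 L (Matrix.specialUnitaryGroup (Fin 2) ℂ)) := (wilsonMeasure (d := 3) (L := L) (fundamentalRep (Fin 2)) β') with hμ
  haveI : IsProbabilityMeasure μ :=
    isProbabilityMeasure_wilsonMeasure (d := 3) (L := L) (fundamentalRep (Fin 2)) (continuous_fundamentalRep (Fin 2)) β'
  set nE : ℝ := (Fintype.card (Edge 3 L) : ℝ) with hnE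
  have hnEpos : 0 < nE := card_edge_three_pos L
  set co : (GaugeConfig 3 L (Matrix.specialUnitaryGroup (Fin 2) ℂ)) → (Edge 3 L × Fin 2 × Fin 2 × Bool → ℝ) := (fun (V : GaugeConfig 3 L (Matrix.specialUnitaryGroup (Fin 2) ℂ)) (q : Edge 3 L × Fin 2 × Fin 2 × Bool) => (fun z : ℂ => if q.2.2.2 then z.im else z.re) ((fundamentalRep (Fin 2) (V q.1) : Matrix (Fin 2) (Fin 2) ℂ) q.2.1 q.2.2.1)) with hco
  -- the two test functions `±Λ_E/#E`
  have key : ∀ b : ℝ, b ≠ 0 →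
      μ.real {V | (∫ V', (fun y : (Edge 3 L × Fin 2 × Fin 2 × Bool → ℝ) => b * ∑ e : Edge 3 L, (((fun (ee : Edge 3 L) => Matrix.of fun (i j : Fin 2) => ((y (ee, i, j, false) : ℝ) : ℂ) + ((y (ee, i, j, true) : ℝ) : ℂ) * Complex.I) e) * Eᴴ).trace.re) (co V') ∂μ) + r ≤ (fun y : (Edge 3 L × Fin 2 × Fin 2 × Bool → ℝ) => b * ∑ e : Edge 3 L, (((fun (ee : Edge 3 L) => Matrix.of fun (i j : Fin 2) => ((y (ee, i, j, false) : ℝ) : ℂ) + ((y (ee, i, j, true) : ℝ) : ℂ) * Complex.I) e) * Eᴴ).trace.re) (co V)} ≤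
        Real.exp (-((1 - 12 * |β'|) * r ^ 2 / (2 * b ^ 2 * (E * Eᴴ).trace.re * nE))) := by
    intro b hb
    have hs : 0 < 2 * b ^ 2 * (E * Eᴴ).trace.re * nE := by
      have : 0 < b ^ 2 := by positivity
      positivity
    exact wilson_concentration_uniform L β' hβ (fun y : (Edge 3 L × Fin 2 × Fin 2 × Bool → ℝ) => b * ∑ e : Edge 3 L, (((fun (ee : Edge 3 L) => Matrix.of fun (i j : Fin 2) => ((y (ee, i, j, false) : ℝ) : ℂ) + ((y (ee, i, j, true) : ℝ) : ℂ) * Complex.I) e) * Eᴴ).trace.re) (contDiff_linkField E b) hs (wilson_linkField_carre_le L β' E b) r hr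
  have hp := key nE⁻¹ (inv_ne_zero hnEpos.ne')
  have hm := key (-nE⁻¹) (neg_ne_zero.2 (inv_ne_zero hnEpos.ne'))
  set fp : (Edge 3 L × Fin 2 × Fin 2 × Bool → ℝ) → ℝ := (fun y : (Edge 3 L × Fin 2 × Fin 2 × Bool → ℝ) => nE⁻¹ * ∑ e : Edge 3 L, (((fun (ee : Edge 3 L) => Matrix.of fun (i j : Fin 2) => ((y (ee, i, j, false) : ℝ) : ℂ) + ((y (ee, i, j, true) : ℝ) : ℂ) * Complex.I) e) * Eᴴ).trace.re) with hfpdef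
  set fm : (Edge 3 L × Fin 2 × Fin 2 × Bool → ℝ) → ℝ := (fun y : (Edge 3 L × Fin 2 × Fin 2 × Bool → ℝ) => (-nE⁻¹) * ∑ e : Edge 3 L, (((fun (ee : Edge 3 L) => Matrix.of fun (i j : Fin 2) => ((y (ee, i, j, false) : ℝ) : ℂ) + ((y (ee, i, j, true) : ℝ) : ℂ) * Complex.I) e) * Eᴴ).trace.re) with hfmdef
  have hvalp : ∀ V : (GaugeConfig 3 L (Matrix.specialUnitaryGroup (Fin 2) ℂ)), fp (co V) = (∑ e : Edge 3 L, ((fundamentalRep (Fin 2) (V e) : Matrix (Fin 2) (Fin 2) ℂ) * Eᴴ).trace.re) / nE := fun V => by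
    have h : fp (co V) = nE⁻¹ * (∑ e : Edge 3 L, ((fundamentalRep (Fin 2) (V e) : Matrix (Fin 2) (Fin 2) ℂ) * Eᴴ).trace.re) := linkField_coords_eq E nE⁻¹ V
    rw [h, div_eq_inv_mul]
  have hvalm : ∀ V : (GaugeConfig 3 L (Matrix.specialUnitaryGroup (Fin 2) ℂ)), fm (co V) = -((∑ e : Edge 3 L, ((fundamentalRep (Fin 2) (V e) : Matrix (Fin 2) (Fin 2) ℂ) * Eᴴ).trace.re) / nE) := fun V => by
    have h : fm (co V) = (-nE⁻¹) * (∑ e : Edge 3 L, ((fundamentalRep (Fin 2) (V e) : Matrix (Fin 2) (Fin 2) ℂ) * Eᴴ).trace.re) := linkField_coords_eq E (-nE⁻¹) V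
    rw [h, div_eq_inv_mul, neg_mul]
  have hmeanp : ∫ V', fp (co V') ∂μ = ∫ V', (∑ e : Edge 3 L, ((fundamentalRep (Fin 2) (V' e) : Matrix (Fin 2) (Fin 2) ℂ) * Eᴴ).trace.re) / nE ∂μ :=
    integral_congr_ae (ae_of_all _ fun V' => by beta_reduce; rw [hvalp V'])
  have hmeanm : ∫ V', fm (co V') ∂μ = -∫ V', (∑ e : Edge 3 L, ((fundamentalRep (Fin 2) (V' e) : Matrix (Fin 2) (Fin 2) ℂ) * Eᴴ).trace.re) / nE ∂μ := by
    rw [← integral_neg]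
    exact integral_congr_ae (ae_of_all _ fun V' => by beta_reduce; rw [hvalm V'])
  have hsub : {V : (GaugeConfig 3 L (Matrix.specialUnitaryGroup (Fin 2) ℂ)) | r ≤ |(∑ e : Edge 3 L, ((fundamentalRep (Fin 2) (V e) : Matrix (Fin 2) (Fin 2) ℂ) * Eᴴ).trace.re) / nE - ∫ V', (∑ e : Edge 3 L, ((fundamentalRep (Fin 2) (V' e) : Matrix (Fin 2) (Fin 2) ℂ) * Eᴴ).trace.re) / nE ∂μ|} ⊆
      {V | (∫ V', fp (co V') ∂μ) + r ≤ fp (co V)} ∪ {V | (∫ V', fm (co V') ∂μ) + r ≤ fm (co V)} := by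
    intro V hV
    simp only [Set.mem_setOf_eq, Set.mem_union] at hV ⊢
    rw [hmeanp, hvalp, hmeanm, hvalm]
    rcases le_abs.1 hV with h | h
    · left; linarith
    · right; linarith
  have e1 : Real.exp (-((1 - 12 * |β'|) * r ^ 2 / (2 * nE⁻¹ ^ 2 * (E * Eᴴ).trace.re * nE))) =
      Real.exp (-((1 - 12 * |β'|) * nE * r ^ 2 / (2 * (E * Eᴴ).trace.re))) := by
    congr 1
    field_simp
  have e2 : Real.exp (-((1 - 12 * |β'|) * r ^ 2 / (2 * (-nE⁻¹) ^ 2 * (E * Eᴴ).trace.re * nE))) =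
      Real.exp (-((1 - 12 * |β'|) * nE * r ^ 2 / (2 * (E * Eᴴ).trace.re))) := by
    rw [neg_sq]; exact e1
  rw [e1] at hp
  rw [e2] at hm
  calc μ.real {V : (GaugeConfig 3 L (Matrix.specialUnitaryGroup (Fin 2) ℂ)) | r ≤ |(∑ e : Edge 3 L, ((fundamentalRep (Fin 2) (V e) : Matrix (Fin 2) (Fin 2) ℂ) * Eᴴ).trace.re) / nE - ∫ V', (∑ e : Edge 3 L, ((fundamentalRep (Fin 2) (V' e) : Matrix (Fin 2) (Fin 2) ℂ) * Eᴴ).trace.re) / nE ∂μ|}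
      ≤ μ.real ({V | (∫ V', fp (co V') ∂μ) + r ≤ fp (co V)} ∪ {V | (∫ V', fm (co V') ∂μ) + r ≤ fm (co V)}) := measureReal_mono hsub
    _ ≤ μ.real {V | (∫ V', fp (co V') ∂μ) + r ≤ fp (co V)} + μ.real {V | (∫ V', fm (co V') ∂μ) + r ≤ fm (co V)} :=
        measureReal_union_le _ _
    _ ≤ Real.exp (-((1 - 12 * |β'|) * nE * r ^ 2 / (2 * (E * Eᴴ).trace.re))) + Real.exp (-((1 - 12 * |β'|) * nE * r ^ 2 / (2 * (E * Eᴴ).trace.re))) :=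
        add_le_add hp hm
    _ = 2 * Real.exp (-((1 - 12 * |β'|) * nE * r ^ 2 / (2 * (E * Eᴴ).trace.re))) := by ring

end Summit.QuantumFields.YangMills.Theorems.ColdStartUniversality
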